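import Literature.InformationTheory.QuantumCodes.GoodQLDPCLemmas
import Literature.InformationTheory.QuantumCodes.SyndromeDecodingCSS
import HarnessLib

/-!
# The decoder clause of the good-qLDPC existence theorems, in the tree's decoder vocabulary
# (Dinur–Hsieh–Lin–Vidick 2022 Thm 1.1, combinatorial part: linear distance ⇒ decoding radius linear in `n`)

`GoodQLDPC.lean` (QEC ladder row type-07) types DHLV22 Theorem 1.1 — "an explicit infinite family of quantum LDPC
codes with maximum weight `w`, rate `r`, and relative distance `δ`. Furthermore these codes are equipped with a
linear time decoder that decodes up to linear distance" — WITHOUT its decoder clause (`TODO(general form)`: the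
printed clause is algorithmic, "linear time", and needs a cost model). Referee qec-type-08 (INBOX 2026-08-26T19:21:32Z)
fixed the tree's vocabulary for the combinatorial content of such a clause: a decoder is `Decoder Syn Err := Syn → Err`
(`SyndromeDecoding.lean`) and "corrects every error of weight `≤ t`" is `D.CorrectsUpTo syn S wt t`; for a CSS pair
the sector forms are `(Decoder.minWeight C.xSyndrome hammingNorm).CorrectsUpTo C.xSyndrome ↑C.rowSpX hammingNorm t`
and its `Z` twin (`SyndromeDecodingCSS.lean`, Delfosse–Nickerson §3: minimum-weight syndrome decoding corrects `t`
errors iff `2t+1 ≤ d`).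

This file PROVES the complexity-free decoder clause for every code/family satisfying the row-07 parameter predicates
(so for the families asserted by `PanteleevKalachev2022_good_qldpc`, `LeverrierZemor2022_quantumTanner`,
`DinurHsiehLinVidick2022_good_qldpc` over `𝔽₂`, and by the PROVED `TillichZemor2014_hgp_sqrt_distance_holds`):

* `IsQLDPCCodeWith.minWeight_correctsUpTo` — a binary `w`-limited CSS pair with `k ≥ K > 0` and `d ≥ D` has, in each
  sector, the canonical minimum-weight syndrome decoder correcting EVERY error of weight `≤ t` whenever
  `2t + 1 ≤ ⌈D⌉` (so radius `⌊(⌈D⌉−1)/2⌋`);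
* `IsQLDPCFamily.exists_minWeight_correctsUpTo` — along a binary family with rate `R > 0` and relative distance
  `δ`: arbitrarily long members whose two minimum-weight decoders correct all errors of weight `≤ ⌊(⌈δn⌉−1)/2⌋`, i.e.
  "decodes up to linear distance" in the combinatorial sense (running time is NOT expressed — that part of DHLV22
  Thm 1.1 / §4 stays untyped).

All proved from `IsQLDPCCodeWith.le_dX/le_dZ/k_pos` (`GoodQLDPCLemmas.lean`) and
`CSSCode.minWeight_correctsUpToX/Z` (`SyndromeDecodingCSS.lean`); no named fact is used or introduced.
-/

namespace Literature.InformationTheory.QuantumCodes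

open Matrix

section Binary

variable {RX RZ Q : Type*} [Fintype RX] [Fintype RZ] [Fintype Q]
  {HX : Matrix RX Q (ZMod 2)} {HZ : Matrix RZ Q (ZMod 2)} {w : ℕ} {K D : ℝ}

/-- **Decoder clause, one code.** For a binary `w`-limited CSS pair with `k ≥ K > 0` and `d ≥ D`, the canonical
minimum-weight `X`- and `Z`-syndrome decoders of the CSS code `(H_X, H_Z)` correct every error of weight `≤ t` as
soon as `2t + 1 ≤ ⌈D⌉` — "decodes up to" half the certified distance (combinatorial content of the decoder clause
of DHLV22 Thm 1.1; running time not expressed).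
[cite: DinurHsiehLinVidick2022, Thm 1.1 (arXiv:2206.07750 chunk p0003 L13-15: "a linear time decoder that decodes up to linear distance")] [cite: DelfosseNickerson2021, §3 ¶2 (minimum-weight decoding corrects `⌊(d−1)/2⌋` errors)] -/
theorem IsQLDPCCodeWith.minWeight_correctsUpTo (h : IsQLDPCCodeWith HX HZ w K D) (hK : 0 < K) {t : ℕ}
    (ht : 2 * t + 1 ≤ ⌈D⌉₊) :
    (Decoder.minWeight (CSSCode.ofMatrices HX HZ h.comm).xSyndrome hammingNorm).CorrectsUpTo
        (CSSCode.ofMatrices HX HZ h.comm).xSyndrome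
        ((CSSCode.ofMatrices HX HZ h.comm).rowSpX : Set (Q → ZMod 2)) hammingNorm t ∧
      (Decoder.minWeight (CSSCode.ofMatrices HX HZ h.comm).zSyndrome hammingNorm).CorrectsUpTo
        (CSSCode.ofMatrices HX HZ h.comm).zSyndrome
        ((CSSCode.ofMatrices HX HZ h.comm).rowSpZ : Set (Q → ZMod 2)) hammingNorm t := by
  have hk := h.k_pos hK
  have hX : ⌈D⌉₊ ≤ (CSSCode.ofMatrices HX HZ h.comm).dX := Nat.ceil_le.2 (h.le_dX hk)
  have hZ : ⌈D⌉₊ ≤ (CSSCode.ofMatrices HX HZ h.comm).dZ := Nat.ceil_le.2 (h.le_dZ hk)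
  exact ⟨(CSSCode.ofMatrices HX HZ h.comm).minWeight_correctsUpToX (ht.trans hX),
    (CSSCode.ofMatrices HX HZ h.comm).minWeight_correctsUpToZ (ht.trans hZ)⟩

/-- The radius form: with `D ≤ d`, the minimum-weight decoders correct all errors of weight `≤ ⌊(⌈D⌉ − 1)/2⌋`.
[cite: DinurHsiehLinVidick2022, Thm 1.1 (arXiv:2206.07750 chunk p0003 L13-15)] [cite: DelfosseNickerson2021, §3 ¶2] -/
theorem IsQLDPCCodeWith.minWeight_correctsUpTo_half (h : IsQLDPCCodeWith HX HZ w K D) (hK : 0 < K) :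
    (Decoder.minWeight (CSSCode.ofMatrices HX HZ h.comm).xSyndrome hammingNorm).CorrectsUpTo
        (CSSCode.ofMatrices HX HZ h.comm).xSyndrome
        ((CSSCode.ofMatrices HX HZ h.comm).rowSpX : Set (Q → ZMod 2)) hammingNorm ((⌈D⌉₊ - 1) / 2) ∧
      (Decoder.minWeight (CSSCode.ofMatrices HX HZ h.comm).zSyndrome hammingNorm).CorrectsUpTo
        (CSSCode.ofMatrices HX HZ h.comm).zSyndrome
        ((CSSCode.ofMatrices HX HZ h.comm).rowSpZ : Set (Q → ZMod 2)) hammingNorm ((⌈D⌉₊ - 1) / 2) := by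
  rcases Nat.eq_zero_or_pos ⌈D⌉₊ with h0 | hpos
  · -- `⌈D⌉ = 0`: radius `0`, and weight-`0` errors are trivially corrected (`2·0+1 ≤ d` since `k > 0 ⇒ d ≥ 1`)
    have hk := h.k_pos hK
    rw [h0]
    refine ⟨(CSSCode.ofMatrices HX HZ h.comm).minWeight_correctsUpToX ?_,
      (CSSCode.ofMatrices HX HZ h.comm).minWeight_correctsUpToZ ?_⟩
    · exact (CSSCode.ofMatrices HX HZ h.comm).dX_pos_of_k_pos hk
    · exact (CSSCode.ofMatrices HX HZ h.comm).dZ_pos_of_k_pos hk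
  · exact h.minWeight_correctsUpTo hK (by omega)

end Binary

/-- **Decoder clause, along a family ("decodes up to linear distance", combinatorial form).** For a binary qLDPC
family with rate `R > 0` and relative distance `δ` (`IsQLDPCFamily 𝔽₂ w R δ`), for every `N` there is a member of
length `n ≥ N` whose canonical minimum-weight `X`- and `Z`-decoders correct EVERY error of weight
`≤ ⌊(⌈δ·n⌉ − 1)/2⌋`. (Running time is not part of the statement.)
[cite: DinurHsiehLinVidick2022, Thm 1.1 (arXiv:2206.07750 chunk p0003 L13-15: "decodes up to linear distance"); §4 Thms 1.5/1.6 (the decoder)] -/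
theorem IsQLDPCFamily.exists_minWeight_correctsUpTo {w : ℕ} {R δ : ℝ} (hF : IsQLDPCFamily (ZMod 2) w R δ)
    (hR : 0 < R) (N : ℕ) :
    ∃ n : ℕ, N ≤ n ∧ ∃ (mX mZ : ℕ) (HX : Matrix (Fin mX) (Fin n) (ZMod 2)) (HZ : Matrix (Fin mZ) (Fin n) (ZMod 2))
      (hc : HX * HZᵀ = 0), IsQLDPCCodeWith HX HZ w (R * n) (δ * n) ∧
      (Decoder.minWeight (CSSCode.ofMatrices HX HZ hc).xSyndrome hammingNorm).CorrectsUpTo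
          (CSSCode.ofMatrices HX HZ hc).xSyndrome
          ((CSSCode.ofMatrices HX HZ hc).rowSpX : Set (Fin n → ZMod 2)) hammingNorm ((⌈δ * n⌉₊ - 1) / 2) ∧
      (Decoder.minWeight (CSSCode.ofMatrices HX HZ hc).zSyndrome hammingNorm).CorrectsUpTo
          (CSSCode.ofMatrices HX HZ hc).zSyndrome
          ((CSSCode.ofMatrices HX HZ hc).rowSpZ : Set (Fin n → ZMod 2)) hammingNorm ((⌈δ * n⌉₊ - 1) / 2) := by
  obtain ⟨n, hn, mX, mZ, HX, HZ, h⟩ := hF (max N 1)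
  have hn1 : 1 ≤ n := (le_max_right _ _).trans hn
  have hK : 0 < R * n := mul_pos hR (by exact_mod_cast hn1)
  exact ⟨n, (le_max_left _ _).trans hn, mX, mZ, HX, HZ, h.comm, h, h.minWeight_correctsUpTo_half hK⟩

end Literature.InformationTheory.QuantumCodes
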